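import Summits.ResolutionOfSingularities.ResolutionOfSingularities.Theorems.PowerLift

/-!
# PowerLiftBridge — slice 2/4 of decomp-res lens-5 g42 «PowerLift» (PIN `PowerLift.lean` sha256 1772eef3, 746 l), §3/§3b marking-free classes and THE BRIDGE `NoTower (a·n) P → NoTower n P`
(monolith lines 200–355); sliced by the writer (g16) at the lens's own cut points for the ≤ 400-line rule (cn41) — declarations,
docstrings and proofs byte-verbatim; only this module docstring, the import of the previous slice and the repeated file header
(`noncomputable section`, `set_option linter.dupNamespace false`, the `open`s, the namespace) are added.  The mathematical
overview, sources and compliance notes are in the module docstring of slice 1 (`Theorems/PowerLift.lean`).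
-/

noncomputable section

set_option linter.dupNamespace false

open CategoryTheory CategoryTheory.Limits AlgebraicGeometry TopologicalSpace IsLocalRing
open Literature.AlgebraicGeometry.Resolution
open Summit.ResolutionOfSingularities.ResolutionOfSingularities.Theorems
open WeakOrderReduction ForcedTowerClasses DivergentTowerClasses MonomialTowerClasses
open HugDimensionClasses HugDimensionKernels SurfaceShadowClasses SurfaceShadowKernels

namespace Summit.ResolutionOfSingularities.ResolutionOfSingularities.Theorems.HugValuationCut

/-! ## §3 Marking-free classes and THE BRIDGE `NoTower (a·n) P → NoTower n P` -/

section Bridge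

/-- **MARKING-FREE (power-stable) tower class**: membership passes from a tower to each of its marking powers. -/
def PowStable (P : ForcedTower → Prop) : Prop :=
  ∀ (T : ForcedTower) (a : ℕ) (hiso : ∀ i, IsIsolatedIn (powMarked (T.D i) a).support (T.pt i))
    (htr : ∀ i, powMarked (T.D (i + 1)) a = (powMarked (T.D i) a).transform (T.π i) (T.centre i)),
    P T → P (powTower T a hiso htr)

/-- **MARKING-INVARIANT tower class**: membership of a marking power is EQUIVALENT to membership of the tower. -/
def PowInvariant (P : ForcedTower → Prop) : Prop :=
  ∀ (T : ForcedTower) (a : ℕ) (hiso : ∀ i, IsIsolatedIn (powMarked (T.D i) a).support (T.pt i))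
    (htr : ∀ i, powMarked (T.D (i + 1)) a = (powMarked (T.D i) a).transform (T.π i) (T.centre i)),
    P (powTower T a hiso htr) ↔ P T

/-- the trivial class is marking-free. [folklore] -/
theorem powStable_true : PowStable fun _ => True := fun _ _ _ _ _ => trivial

/-- invariant classes are stable. [folklore] -/
theorem PowInvariant.stable {P : ForcedTower → Prop} (h : PowInvariant P) : PowStable P :=
  fun T a hiso htr hP => (h T a hiso htr).mpr hP

/-- complements of invariant classes are stable. [folklore] -/
theorem PowInvariant.not {P : ForcedTower → Prop} (h : PowInvariant P) : PowInvariant fun T => ¬ P T :=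
  fun T a hiso htr => not_congr (h T a hiso htr)

/-- intersections of invariant classes are invariant. [folklore] -/
theorem PowInvariant.and {P Q : ForcedTower → Prop} (hP : PowInvariant P) (hQ : PowInvariant Q) :
    PowInvariant fun T => P T ∧ Q T :=
  fun T a hiso htr => and_congr (hP T a hiso htr) (hQ T a hiso htr)

/-- intersections of stable classes are stable. [folklore] -/
theorem PowStable.and {P Q : ForcedTower → Prop} (hP : PowStable P) (hQ : PowStable Q) :
    PowStable fun T => P T ∧ Q T :=
  fun T a hiso htr h => ⟨hP T a hiso htr h.1, hQ T a hiso htr h.2⟩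

/-- **THE BRIDGE (KERNEL, hypothesis-free): `NoTower (a·n) P → NoTower n P` for every marking-free class and every `a ≥ 1`**
— an infinite tower of weight `n` in `P` has its `a`-th marking power, an infinite tower of weight `a·n` in `P` over the SAME
base.  The terminating weights of a marking-free class form a DIVISOR-CLOSED set.
[cite: BierstoneGrigorievMilmanWlodarczyk2011, Example 3.4.2, Lemma 3.7.1] -/
theorem noTower_of_noTower_mul {n a : ℕ} (ha : 0 < a) {P : ForcedTower → Prop} (hP : PowStable P)
    (h : NoTower (a * n) P) : NoTower n P := by
  intro p hp k _ _ T g hB hD hE hPT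
  exact h p hp k (powTower T a (powTower_hiso T g hB ha) (powTower_htr T g hB hD a)) g hB
    (powTower_isDatum T g hB hD a _ _) hE (hP T a _ _ hPT)

/-- **`ForcedTowersTerminate (a·n) → ForcedTowersTerminate n`** (`a ≥ 1`). [folklore] -/
theorem forcedTowersTerminate_of_mul {n a : ℕ} (ha : 0 < a) (h : ForcedTowersTerminate (a * n)) :
    ForcedTowersTerminate n :=
  forcedTowersTerminate_iff_noTower.mpr
    (noTower_of_noTower_mul ha powStable_true (forcedTowersTerminate_iff_noTower.mp h))

/-- **The DEPTH-`J` column** of a tower class: «no infinite forced tower of the class with `p^J ∣ n` satisfies `P`»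
(`J = 0`: the whole class; `J = 1`: the wild-weight column `NoTowerWild` of g21). -/
def NoTowerDeep (J n : ℕ) (P : ForcedTower → Prop) : Prop :=
  ∀ p : ℕ, p.Prime → p ^ J ∣ n → ∀ (k : Type) [Field k] [CharP k p] (T : ForcedTower) (g : T.St 0 ⟶ Spec (.of k)),
    IsBase (T.St 0) g → IsDatum n (T.D 0) → (T.D 0).boundary = [] → P T → False

/-- `NoTowerDeep 0 = NoTower`. [folklore] -/
theorem noTowerDeep_zero_iff {n : ℕ} {P : ForcedTower → Prop} : NoTowerDeep 0 n P ↔ NoTower n P :=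
  ⟨fun h p hp k _ _ T g hB hD hE hP => h p hp (by rw [pow_zero]; exact one_dvd n) k T g hB hD hE hP,
    fun h p hp _ k _ _ T g hB hD hE hP => h p hp k T g hB hD hE hP⟩

/-- `NoTowerDeep 1 = NoTowerWild` (g21's wild-weight column). [folklore] -/
theorem noTowerDeep_one_iff {n : ℕ} {P : ForcedTower → Prop} : NoTowerDeep 1 n P ↔ NoTowerWild n P :=
  ⟨fun h p hp hpn k _ _ T g hB hD hE hP => h p hp (by rwa [pow_one]) k T g hB hD hE hP,
    fun h p hp hpn k _ _ T g hB hD hE hP => h p hp (by rwa [pow_one] at hpn) k T g hB hD hE hP⟩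

/-- every column of a terminating class terminates. [folklore] -/
theorem noTowerDeep_of_noTower {J n : ℕ} {P : ForcedTower → Prop} (h : NoTower n P) : NoTowerDeep J n P :=
  fun p hp _ k _ _ T g hB hD hE hP => h p hp k T g hB hD hE hP

/-- deeper columns are smaller. [folklore] -/
theorem noTowerDeep_mono {J J' n : ℕ} (hJ : J ≤ J') {P : ForcedTower → Prop} (h : NoTowerDeep J n P) :
    NoTowerDeep J' n P :=
  fun p hp hpn k _ _ T g hB hD hE hP => h p hp ((pow_dvd_pow p hJ).trans hpn) k T g hB hD hE hP

/-- monotonicity in the class. [folklore] -/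
theorem noTowerDeep_mono_class {J n : ℕ} {P Q : ForcedTower → Prop} (hPQ : ∀ T, Q T → P T) (h : NoTowerDeep J n P) :
    NoTowerDeep J n Q :=
  fun p hp hpn k _ _ T g hB hD hE hQ => h p hp hpn k T g hB hD hE (hPQ T hQ)

/-- **BASE RANGE ↦ ASYMPTOTIC REGIME (KERNEL, hypothesis-free)**: for a marking-free class, termination at the weights
divisible by `p^J` (for the prime `p` at hand) gives termination at EVERY weight — bridge `T ↦ T^{p^J}`.
[cite: BierstoneGrigorievMilmanWlodarczyk2011, Example 3.4.2, Lemma 3.7.1] -/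
theorem noTower_of_noTowerDeep (J : ℕ) {P : ForcedTower → Prop} (hP : PowStable P)
    (h : ∀ N : ℕ, 1 ≤ N → NoTowerDeep J N P) : ∀ n : ℕ, 1 ≤ n → NoTower n P := by
  intro n hn p hp k _ _ T g hB hD hE hPT
  have ha : 0 < p ^ J := pow_pos hp.pos J
  exact h (p ^ J * n) (le_trans hn (Nat.le_mul_of_pos_left n ha)) p hp (dvd_mul_right _ _) k
    (powTower T (p ^ J) (powTower_hiso T g hB ha) (powTower_htr T g hB hD (p ^ J))) g hB
    (powTower_isDatum T g hB hD (p ^ J) _ _) hE (hP T (p ^ J) _ _ hPT)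

/-- **EXACT: a marking-free class terminates at all weights iff it terminates on its depth-`J` column, for EVERY `J`.**
[folklore] -/
theorem noTower_all_iff_deep (J : ℕ) {P : ForcedTower → Prop} (hP : PowStable P) :
    (∀ n : ℕ, 1 ≤ n → NoTower n P) ↔ ∀ n : ℕ, 1 ≤ n → NoTowerDeep J n P :=
  ⟨fun h n hn => noTowerDeep_of_noTower (h n hn), noTower_of_noTowerDeep J hP⟩

/-- **EXACT: a marking-free class terminates at all weights iff its WILD-WEIGHT column does** — the TAME column (`p ∤ n`)
is redundant. [folklore] -/
theorem noTower_all_iff_wild {P : ForcedTower → Prop} (hP : PowStable P) :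
    (∀ n : ℕ, 1 ≤ n → NoTower n P) ↔ ∀ n : ℕ, 1 ≤ n → NoTowerWild n P :=
  (noTower_all_iff_deep 1 hP).trans (forall₂_congr fun _ _ => noTowerDeep_one_iff)

/-! ### §3b The RELATIVE bridge modulo the monomial class (`¬ EventuallyMonomial ∧ Q`, `Q` marking-free) -/

/-- **THE RELATIVE BRIDGE (KERNEL): `MonomialTowersTerminate (a·n) → NoTower (a·n) (¬ monomial ∧ Q) → NoTower n Q`**
for every marking-free `Q` and `a ≥ 1` — the marking power `T^a` of a weight-`n` tower in `Q` is in `Q`; if it is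
eventually monomial the monomial class kills it, otherwise the never-monomial `Q`-column at weight `a·n` does.  (The
letter `EventuallyMonomial` READS the marking and is not transported; it is DISPATCHED.) [folklore] -/
theorem noTower_of_noTower_mul_of_monomial {n a : ℕ} (ha : 0 < a) {Q : ForcedTower → Prop} (hQ : PowStable Q)
    (hM : MonomialTowersTerminate (a * n)) (h : NoTower (a * n) fun T => ¬ EventuallyMonomial T ∧ Q T) :
    NoTower n Q := by
  intro p hp k _ _ T g hB hD hE hQT
  have hiso := powTower_hiso T g hB ha
  have htr := powTower_htr T g hB hD a
  by_cases hmono : EventuallyMonomial (powTower T a hiso htr)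
  · exact hM p hp k (powTower T a hiso htr) g hB (powTower_isDatum T g hB hD a hiso htr) hE hmono
  · exact h p hp k (powTower T a hiso htr) g hB (powTower_isDatum T g hB hD a hiso htr) hE
      ⟨hmono, hQ T a hiso htr hQT⟩

/-- **RELATIVE BASE RANGE ↦ ASYMPTOTIC REGIME**: modulo the monomial class at all weights, the never-monomial
`Q`-column on the depth-`J` weights gives the whole `Q`-column. [folklore] -/
theorem noTower_of_noTowerDeep_of_monomial (J : ℕ) {Q : ForcedTower → Prop} (hQ : PowStable Q)
    (hM : ∀ N : ℕ, 1 ≤ N → MonomialTowersTerminate N)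
    (h : ∀ N : ℕ, 1 ≤ N → NoTowerDeep J N fun T => ¬ EventuallyMonomial T ∧ Q T) :
    ∀ n : ℕ, 1 ≤ n → NoTower n Q := by
  intro n hn p hp k _ _ T g hB hD hE hQT
  have ha : 0 < p ^ J := pow_pos hp.pos J
  have hN : 1 ≤ p ^ J * n := le_trans hn (Nat.le_mul_of_pos_left n ha)
  have hiso := powTower_hiso T g hB ha
  have htr := powTower_htr T g hB hD (p ^ J)
  by_cases hmono : EventuallyMonomial (powTower T (p ^ J) hiso htr)
  · exact hM _ hN p hp k (powTower T (p ^ J) hiso htr) g hB (powTower_isDatum T g hB hD (p ^ J) hiso htr) hE hmono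
  · exact h _ hN p hp (dvd_mul_right _ _) k (powTower T (p ^ J) hiso htr) g hB
      (powTower_isDatum T g hB hD (p ^ J) hiso htr) hE ⟨hmono, hQ T (p ^ J) hiso htr hQT⟩

/-- **EXACT modulo the monomial class: a never-monomial marking-free column terminates at all weights iff it does
on its depth-`J` weights**, every `J`. [folklore] -/
theorem noTower_nonMonomial_all_iff_deep (J : ℕ) {Q : ForcedTower → Prop} (hQ : PowStable Q)
    (hM : ∀ N : ℕ, 1 ≤ N → MonomialTowersTerminate N) :
    (∀ n : ℕ, 1 ≤ n → NoTower n fun T => ¬ EventuallyMonomial T ∧ Q T) ↔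
      ∀ n : ℕ, 1 ≤ n → NoTowerDeep J n fun T => ¬ EventuallyMonomial T ∧ Q T :=
  ⟨fun h n hn => noTowerDeep_of_noTower (h n hn), fun h n hn =>
    noTower_mono (fun _ hT => hT.2) (noTower_of_noTowerDeep_of_monomial J hQ hM h n hn)⟩

/-- **EXACT modulo the monomial class: … iff it does on its WILD weights.** [folklore] -/
theorem noTower_nonMonomial_all_iff_wild {Q : ForcedTower → Prop} (hQ : PowStable Q)
    (hM : ∀ N : ℕ, 1 ≤ N → MonomialTowersTerminate N) :
    (∀ n : ℕ, 1 ≤ n → NoTower n fun T => ¬ EventuallyMonomial T ∧ Q T) ↔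
      ∀ n : ℕ, 1 ≤ n → NoTowerWild n fun T => ¬ EventuallyMonomial T ∧ Q T :=
  (noTower_nonMonomial_all_iff_deep 1 hQ hM).trans (forall₂_congr fun _ _ => noTowerDeep_one_iff)

end Bridge

end Summit.ResolutionOfSingularities.ResolutionOfSingularities.Theorems.HugValuationCut
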